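import Summits.BirchSwinnertonDyer.BirchSwinnertonDyer.Theorems.KolyvaginDepthDoorKNSupplyResidualStructureOfPrint
import Summits.BirchSwinnertonDyer.BirchSwinnertonDyer.Theorems.KolyvaginDepthDoorKNSupplyLevelOneStructure
import Literature.NumberTheory.EllipticCurves.IrreducibleModPQuadraticTwistProofs
import HarnessLib

/-!
# Route `KolyvaginDepthDoor`, crux `KolyvaginDepthSupplyKN` (stmt-BirchSwinnertonDyer-22820) —
# THE RANK-2 SLICE AT LEVEL ONE ON THE WHOLE KODAIRA–NÉRON CELL (♠ (2)-residual INCLUDED): the supply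
# half from print (BCGS 2026 Thm. 2 ∘ Zanarella 2019 ∘ Howard–Zanarella) on a `p`-optimal frame

Helper file of the lead prover of line `levelone` (kdd-p1 g13; `--supports stmt-BirchSwinnertonDyer-22820
--as helper`); it closes nothing and BSD is not proved by it. The critic's price of the D-0145 line is
«depth table / rank-2 slice». g11's slice (`KolyvaginDepthDoorKNSupplyRankTwoSlice`,
`exists_kolyvaginClass_one_prime_ne_zero_of_rank_two_of_sha_trivial`) supplies, from `Ш(E/ℚ)[p] = 0`
on a rank-2 curve, a level-one class `c_1(ℓ) ≠ 0` at exactly ONE Kolyvagin prime — on W. Zhang's ♠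
cell only (named fact `WZhang2014_lemma84_…`, Hypothesis ♠ (2)); the three rank-2 depth-table curves
`664a1` (`2³·83`), `916c1` (`2²·229`), `944e1` (`2⁴·59`) lie in the ♠ (2)-residual, where that supply
was not backed by print. With the print route of skeleton v7/v8 (this seat:
`exists_minimal_kolyvaginClass_one_selmerCard_of_thm2_of_zanarella_of_rigidity`, file
`KolyvaginDepthDoorKNSupplyModPRigidity`, modulo BCGS 2026 Thm. 2 + Zanarella 2019 Prop. 2.18 + the
Howard–Zanarella rigidity fact) the same supply holds on the WHOLE Kodaira–Néron cell, for any
`p`-OPTIMAL frame with `p` split in `K` and `d_K` odd: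

* `exists_kolyvaginClass_one_prime_ne_zero_of_rank_two_of_sha_trivial_of_print` — `E/ℚ` globally
  minimal of Mordell–Weil rank `2`; `p ≥ 5` good ordinary, `ρ̄_{E,p}` and the tower onto,
  `p ∤ ord_v(Δ_min)` at multiplicative places (NO ♠ (2), NO square-free `N`); `K` imaginary quadratic
  Heegner with `d_K` odd, `≠ −3, −4`, `p ∤ d_K`, `p` split, `(d_K, N) = 1`; twist side pinned
  (`rank E^{(d_K)} ≤ 1`, `Ш(E^{(d_K)})[p] = 0`); a `p`-optimal frame `(Dt, β, ι)`. IF `Ш(E/ℚ)[p] = 0`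
  THEN ON THAT FRAME there is ONE Kolyvagin prime `ℓ` and a datum of conductor `ℓ` with `c_1(ℓ) ≠ 0`,
  and every depth-`0` class `c_1(1)` of the frame vanishes — the «←» direction of the residual curves'
  depth-table rows, now modulo print (the «→» direction is the g8/g9 KN door of a datum, (γ) only,
  `shaCorank_eq_zero_of_kolyvaginClass_ne_zero_of_rank_le_of_datum_kodairaNeron`).

CONDITIONAL on the three named facts; per curve; BSD is NOT proved by this.

References: [BurungaleEtAl2026] Thm. 2; [Zanarella2019] Prop. 2.18, Cor. 2.12, 2.14; [Howard2004]
Lemma 1.6.4; [WZhang2014] Lemma 8.4 (1) (shape); [SilvermanAEC2009] X.4.2; [JetchevLauterStein2009] §3.6.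
-/

set_option linter.dupNamespace false

noncomputable section

open scoped Classical NumberField

namespace Summit.BirchSwinnertonDyer.BirchSwinnertonDyer.Theorems.KolyvaginDepthDoor

open Literature.NumberTheory.EllipticCurves Literature.NumberTheory.EllipticCurves.ModularForms
  WeierstrassCurve NumberField IsDedekindDomain

/-- A square-free natural number with exactly one prime factor is prime (bookkeeping for
`ν(n) = 1`). [folklore] -/
private theorem prime_of_squarefree_of_card_primeFactors_eq_one₈ {n : ℕ} (hsq : Squarefree n)
    (h1 : n.primeFactors.card = 1) : n.Prime := by
  obtain ⟨ℓ, hℓ⟩ := Finset.card_eq_one.mp h1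
  have hℓmem : ℓ ∈ n.primeFactors := by rw [hℓ]; exact Finset.mem_singleton_self ℓ
  have hℓp : ℓ.Prime := Nat.prime_of_mem_primeFactors hℓmem
  have hprod : ∏ q ∈ n.primeFactors, q = n := Nat.prod_primeFactors_of_squarefree hsq
  rw [hℓ, Finset.prod_singleton] at hprod
  rw [← hprod]
  exact hℓp

/-- **Supply at rank 2, level one, on the whole Kodaira–Néron cell (modulo BCGS 2026 Thm. 2 +
Zanarella 2019 Prop. 2.18 + Howard–Zanarella rigidity; NO Hypothesis ♠ (2)).** `E/ℚ` globally minimal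
of Mordell–Weil rank `2`; `p ≥ 5` good ordinary with `ρ̄_{E,p}` and the tower `ρ_{E,p^n}` onto and
`p ∤ ord_v(Δ_min)` at every multiplicative place; `K` imaginary quadratic Heegner with `d_K` odd,
`≠ −3, −4`, `p ∤ d_K`, `p` split in `K`, `(d_K, N) = 1`; `rank E^{(d_K)}(ℚ) ≤ 1` and
`Ш(E^{(d_K)}/ℚ)[p] = 0`; a `p`-optimal frame `(Dt, β, ι)`. IF `Ш(E/ℚ)[p] = 0` THEN on that frame
there are ONE Kolyvagin prime `ℓ` and a datum of conductor `ℓ` with `c_1(ℓ) ≠ 0` in `H¹(K, E[p])`, and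
EVERY depth-`0` class `c_1(1)` of the frame vanishes. (Descent counts `#Sel_p(E) = p²`,
`#Sel_p(E^{(d_K)}) ≤ p`; the print dichotomy at the minimal class forces the `E`-side with `ν = 1`.)
CONDITIONAL on the three named facts; BSD is not proved by it.
[cite: BurungaleEtAl2026, Thm. 2 (arXiv:2312.09301 §0.1)] [cite: Zanarella2019, Prop. 2.18, Cor. 2.12, Cor. 2.14]
[cite: Howard2004, Lemma 1.6.4] [cite: SilvermanAEC2009, Thm. X.4.2] -/
theorem exists_kolyvaginClass_one_prime_ne_zero_of_rank_two_of_sha_trivial_of_print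
    (h2 : BurungaleEtAl2026.thm2_kolyvaginClass_divisibility_eq_padicValNat_tamagawaProduct)
    (hZ : Literature.NumberTheory.EllipticCurves.Zanarella2019_kolyvaginClass_one_ne_zero_of_not_divisible)
    (hHZ : Literature.NumberTheory.EllipticCurves.HowardZanarella_exists_minimal_kolyvaginClass_one_selmerCard_of_ne_zero)
    (W : WeierstrassCurve ℚ) [W.IsElliptic] [W.IsGloballyMinimal] (hr : W.mordellWeilRank = 2)
    (p : ℕ) [hp : Fact p.Prime] (h5 : 5 ≤ p) (hgood : W.HasGoodReductionAtPrime p)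
    (hord : ¬ (p : ℤ) ∣ W.frobeniusTrace p) (hsurj : W.HasSurjectiveModNGaloisRep p)
    (htower : ∀ n : ℕ, W.HasSurjectiveModNGaloisRep (p ^ n : ℕ))
    (hKN : ∀ v : HeightOneSpectrum (𝓞 ℚ), W.HasMultiplicativeReductionAt v →
      ¬ p ∣ W.ordMinimalDiscriminant v)
    (K : Type) [Field K] [NumberField K] (hK : IsImaginaryQuadratic K)
    (hodd : Odd (NumberField.discr K)) (hD3 : NumberField.discr K ≠ -3) (hD4 : NumberField.discr K ≠ -4)
    (hpD : ¬ ((p : ℤ) ∣ NumberField.discr K)) (hspl : SatisfiesHeegnerHypothesis p K)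
    (hDN : IsCoprime (NumberField.discr K) ((W.conductorNorm ℤ : ℕ) : ℤ))
    [NeZero (W.conductorNorm ℤ)] (hHeeg : SatisfiesHeegnerHypothesis (W.conductorNorm ℤ) K)
    (hT1 : (W.quadraticTwist (NumberField.discr K : ℚ)).mordellWeilRank ≤ 1)
    (hshaT : ((W.quadraticTwist (NumberField.discr K : ℚ)).sha ⊓
        AddSubgroup.torsionBy (W.quadraticTwist (NumberField.discr K : ℚ)).galH1 (p : ℤ) :
        AddSubgroup (W.quadraticTwist (NumberField.discr K : ℚ)).galH1) = ⊥)
    (hshaW : (W.sha ⊓ AddSubgroup.torsionBy W.galH1 (p : ℤ) : AddSubgroup W.galH1) = ⊥)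
    (Dt : ModularParametrizationData W (W.conductorNorm ℤ)) (hopt : Dt.IsPOptimal p)
    (β : ℤ) (hβ : (4 * (W.conductorNorm ℤ : ℤ)) ∣ β ^ 2 - NumberField.discr K) (ι : K →+* ℂ) :
    ∃ (ℓ : ℕ) (d : KolyvaginHeegnerData Dt β ι ℓ),
      ℓ.Prime ∧ Zhang2014.IsKolyvaginPrime (W.conductorNorm ℤ) W K p ℓ ∧
        d.kolyvaginClass hp.out 1 ≠ 0 ∧
        ∀ d₀ : KolyvaginHeegnerData Dt β ι 1, d₀.kolyvaginClass hp.out 1 = 0 := by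
  have htam : ¬ p ∣ W.tamagawaProduct := not_dvd_tamagawaProduct_of_kodairaNeron W p h5 hKN
  obtain ⟨n, d, hsupp, hne, hmin, hdich⟩ :=
    exists_minimal_kolyvaginClass_one_selmerCard_of_thm2_of_zanarella_of_rigidity h2 hZ hHZ W p h5
      hgood hord hsurj htower htam K hK hHeeg hodd hD3 hD4 hDN hpD hspl Dt hopt β hβ ι
  have hpP : p.Prime := hp.out
  have h2p : 2 ≤ p := hpP.two_le
  haveI : NeZero (p : ℚ) := ⟨by exact_mod_cast hpP.ne_zero⟩
  have hirr : W.HasIrreducibleModPGaloisRep p :=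
    hasIrreducibleModPGaloisRep_of_hasSurjectiveModNGaloisRep W p hsurj
  have hdK : (NumberField.discr K : ℚ) ≠ 0 := by exact_mod_cast NumberField.discr_ne_zero K
  haveI := W.isElliptic_quadraticTwist hdK
  have hirrT : (W.quadraticTwist (NumberField.discr K : ℚ)).HasIrreducibleModPGaloisRep p :=
    (W.hasIrreducibleModPGaloisRep_quadraticTwist_iff hdK p).mpr hirr
  have hSelW : Nat.card (W.selmerGroup p) = p ^ 2 := by
    rw [← hr]; exact natCard_selmerGroup_eq_pow_rank_of_sha_inf_torsionBy_eq_bot W p hirr hshaW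
  have hSelT : Nat.card ((W.quadraticTwist (NumberField.discr K : ℚ)).selmerGroup p) =
      p ^ (W.quadraticTwist (NumberField.discr K : ℚ)).mordellWeilRank :=
    natCard_selmerGroup_eq_pow_rank_of_sha_inf_torsionBy_eq_bot _ p hirrT hshaT
  -- the minimal non-zero level-one class has depth exactly `1`
  have hν : n.primeFactors.card = 1 := by
    rcases hdich with ⟨hW1, -⟩ | ⟨hT1', hW2⟩
    · rw [hSelW] at hW1
      have := Nat.pow_right_injective h2p hW1
      omega
    · exfalso
      rw [hSelT] at hT1'
      have h1 := Nat.pow_right_injective h2p hT1'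
      have h0 : n.primeFactors.card = 0 := by omega
      rw [hSelW, h0, pow_zero] at hW2
      have : 2 ^ 2 ≤ p ^ 2 := Nat.pow_le_pow_left h2p 2
      omega
  have hn : n.Prime := prime_of_squarefree_of_card_primeFactors_eq_one₈ hsupp.1 hν
  have hmem : n ∈ n.primeFactors := by
    rw [hn.primeFactors]; exact Finset.mem_singleton_self n
  refine ⟨n, d, hn, hsupp.2 n hmem, hne, fun d₀ ↦ ?_⟩
  -- every depth-0 class of the frame vanishes, by minimality
  by_contra h0
  have := hmin 1 d₀ (KolyvaginDescent.kolSupp_one _) h0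
  rw [hν, Nat.primeFactors_one, Finset.card_empty] at this
  omega

end Summit.BirchSwinnertonDyer.BirchSwinnertonDyer.Theorems.KolyvaginDepthDoor

end
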